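import Literature.NumberTheory.EllipticCurves.EichlerIntegralWeierstrassProofs
import Mathlib.Analysis.Meromorphic.NormalForm
import HarnessLib

/-!
# Orders of `℘_Λ(2πi∫f)`: at its poles, under `Γ₀(N)`, and at the cusps

Topic `NumberTheory/EllipticCurves`; a proofs-only file (theorems only, no definitions, no named
facts). Let `f ∈ S₂(Γ₀(N))`, `u = 2πi∫_{i∞} f` (`eichlerIntegral f`), `Λ = Λ(L)` a lattice and
`x(τ) = ℘_Λ(u(τ))`, a meromorphic function on `ℍ` (as a function of the complex variable,
`X(w) = ℘_Λ(u(w))`, `im w > 0`). This file computes the orders needed to present `x` as a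
quotient of cusp forms (the construction of a holomorphic "denominator" killing the poles of a
meromorphic function on `X₀(N)`; Shimura 1971, §2.4, Diamond–Shurman 2005, §3.1–3.2):

* `meromorphicOrderAt_weierstrassP_eichlerIntegral` — at a pole `w₀` (`u(w₀) ∈ Λ`) the order of
  `X` is `−2·ord_{w₀}(u − u(w₀))` (Mathlib: `℘_Λ` has order `−2` at lattice points,
  `PeriodPair.order_weierstrassP`, and orders multiply under composition).
* `meromorphicOrderAt_weierstrassP_eichlerIntegral_smul` — the order of `X` is the same at `w`
  and at `γw`, `γ ∈ Γ₀(N)` (`x ∘ γ = x` and `γ` is biholomorphic).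
* `meromorphicOrderAt_mul_nonneg_of_natCast_le` — if `X` has order `−n` at `w₀` and `g` is
  holomorphic at `w₀` vanishing to order `≥ n`, then `Xg` has a removable singularity at `w₀`
  (`analyticAt_toMeromorphicNFOn`: its normal form is holomorphic there).
* `IsCuspFunction.tendsto_weierstrassP_mul_pow_atImInfty` — **at a cusp**: for cuspidal
  `q_h`-series `V ≢ 0` and `D`, `℘_Λ(C + V(τ))·D(τ)^a → 0` as `im τ → ∞` once
  `a > 2·ord₀ V̂` (`V̂` the `q`-expansion of `V`): the function `℘_Λ(C + V̂(q))D̂(q)^a` on the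
  `q`-disc is meromorphic at `q = 0` of order `≥ a − 2·ord₀ V̂ > 0`.

## References

* G. Shimura, *Introduction to the arithmetic theory of automorphic functions*, 1971: §2.4.
  [ShimuraIATAF1971]
* F. Diamond, J. Shurman, *A First Course in Modular Forms*, GTM 228, 2005: §3.1, §3.2.
  [DiamondShurman2005]
-/

noncomputable section

open Complex Filter Topology Set Function
open UpperHalfPlane hiding I
open scoped Real Topology Manifold MatrixGroups PeriodPair ModularForm

open Literature.NumberTheory.EllipticCurves

namespace Literature.NumberTheory.EllipticCurves.ModularForms

open CongruenceSubgroup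

variable {N : ℕ} [NeZero N]

/-! ### `X = ℘_Λ ∘ u` is meromorphic; its order at a pole -/

/-- `w ↦ ℘_Λ(u(w))` is meromorphic at every point of the upper half-plane (`℘_Λ` is meromorphic
on `ℂ`, `u` is holomorphic). [folklore] -/
theorem meromorphicAt_weierstrassP_eichlerIntegral (f : CuspForm (Gamma0 N) 2) (L : PeriodPair)
    {z : ℂ} (hz : 0 < z.im) :
    MeromorphicAt (fun w : ℂ ↦ ℘[L] (eichlerIntegral f (ofComplex w))) z :=
  (L.meromorphic_weierstrassP _).comp_analyticAt (analyticAt_eichlerIntegral_comp_ofComplex f hz)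

/-- For `f ≠ 0` the Eichler integral is not eventually constant at any point of the half-plane
(filter form of `not_eventually_const_eichlerIntegral`). [folklore] -/
theorem not_eventuallyConst_eichlerIntegral (f : CuspForm (Gamma0 N) 2) (hf : f ≠ 0) {z : ℂ}
    (hz : 0 < z.im) :
    ¬ EventuallyConst (fun w : ℂ ↦ eichlerIntegral f (ofComplex w)) (𝓝 z) := by
  rw [eventuallyConst_iff_exists_eventuallyEq]
  rintro ⟨c, hc⟩
  exact not_eventually_const_eichlerIntegral f hf hz c hc

/-- The order of vanishing of `u − u(z)` at `z` is finite (for `f ≠ 0`). [folklore] -/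
theorem analyticOrderAt_eichlerIntegral_sub_ne_top (f : CuspForm (Gamma0 N) 2) (hf : f ≠ 0)
    {z : ℂ} (hz : 0 < z.im) :
    analyticOrderAt (fun w : ℂ ↦ eichlerIntegral f (ofComplex w) - eichlerIntegral f (ofComplex z))
      z ≠ ⊤ := by
  rw [Ne, ← eventuallyConst_iff_analyticOrderAt_sub_eq_top]
  exact not_eventuallyConst_eichlerIntegral f hf hz

/-- **Order of `℘_Λ(u)` at a pole.** If `u(z) ∈ Λ` then the meromorphic order of
`w ↦ ℘_Λ(u(w))` at `z` is `−2m`, `m = ord_z(u − u(z))` (`℘_Λ` has a double pole at each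
lattice point, Mathlib `PeriodPair.order_weierstrassP`, and orders multiply under composition
with the non-constant holomorphic `u`). [folklore] -/
theorem meromorphicOrderAt_weierstrassP_eichlerIntegral (f : CuspForm (Gamma0 N) 2) (hf : f ≠ 0)
    (L : PeriodPair) {z : ℂ} (hz : 0 < z.im) (hzL : eichlerIntegral f (ofComplex z) ∈ L.lattice) :
    meromorphicOrderAt (fun w : ℂ ↦ ℘[L] (eichlerIntegral f (ofComplex w))) z =
      (((-2 : ℤ) * (analyticOrderNatAt (fun w : ℂ ↦
        eichlerIntegral f (ofComplex w) - eichlerIntegral f (ofComplex z)) z : ℕ) : ℤ) :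
        WithTop ℤ) := by
  have hUa := analyticAt_eichlerIntegral_comp_ofComplex f hz
  have hnc := not_eventuallyConst_eichlerIntegral f hf hz
  have hfin := analyticOrderAt_eichlerIntegral_sub_ne_top f hf hz
  have hcomp : (fun w : ℂ ↦ ℘[L] (eichlerIntegral f (ofComplex w))) =
      ℘[L] ∘ fun w : ℂ ↦ eichlerIntegral f (ofComplex w) := rfl
  rw [hcomp, (L.meromorphic_weierstrassP _).meromorphicOrderAt_comp hUa hnc,
    L.order_weierstrassP _ hzL, ← Nat.cast_analyticOrderNatAt hfin, ENat.map_coe,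
    show (-2 : WithTop ℤ) = ((-2 : ℤ) : WithTop ℤ) by norm_num, ← WithTop.coe_mul]

/-! ### Invariance of the order under `Γ₀(N)` -/

/-- The Möbius transformation of `γ ∈ SL(2, ℤ)` is analytic at every point of the upper
half-plane. [folklore] -/
theorem analyticAt_moebius (γ : SL(2, ℤ)) {z : ℂ} (hz : 0 < z.im) : AnalyticAt ℂ (moebius γ) z :=
  DifferentiableOn.analyticAt (s := {w : ℂ | 0 < w.im})
    (fun _ hw ↦ (hasDerivAt_moebius γ hw).differentiableAt.differentiableWithinAt)
    (isOpen_upperHalfPlaneSet.mem_nhds hz)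

/-- The Möbius transformation of `γ ∈ SL(2, ℤ)` has non-vanishing derivative `(cz + d)⁻²` on
the upper half-plane. [folklore] -/
theorem deriv_moebius_ne_zero (γ : SL(2, ℤ)) {z : ℂ} (hz : 0 < z.im) : deriv (moebius γ) z ≠ 0 := by
  rw [(hasDerivAt_moebius γ hz).deriv]
  exact div_ne_zero one_ne_zero (pow_ne_zero 2 (moebius_denom_ne_zero γ hz))

/-- **The order of `℘_Λ(u)` is `Γ₀(N)`-invariant**: if `Λ_f ⊆ Λ` and `γ ∈ Γ₀(N)`, the order of
`w ↦ ℘_Λ(u(w))` at `γz` equals its order at `z` (`℘_Λ(u(γw)) = ℘_Λ(u(w))`,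
`weierstrassP_eichlerIntegral_gamma_smul`, and `w ↦ γw` is biholomorphic). [folklore] -/
theorem meromorphicOrderAt_weierstrassP_eichlerIntegral_moebius (f : CuspForm (Gamma0 N) 2)
    (L : PeriodPair) (hΛ : ∀ x ∈ periodLattice f, x ∈ L.lattice) (γ : Gamma0 N) {z : ℂ}
    (hz : 0 < z.im) :
    meromorphicOrderAt (fun w : ℂ ↦ ℘[L] (eichlerIntegral f (ofComplex w)))
        (moebius (γ : SL(2, ℤ)) z) =
      meromorphicOrderAt (fun w : ℂ ↦ ℘[L] (eichlerIntegral f (ofComplex w))) z := by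
  rw [← meromorphicOrderAt_comp_of_deriv_ne_zero (f := fun w : ℂ ↦ ℘[L]
    (eichlerIntegral f (ofComplex w))) (analyticAt_moebius _ hz) (deriv_moebius_ne_zero _ hz)]
  apply meromorphicOrderAt_congr
  apply Filter.Eventually.filter_mono nhdsWithin_le_nhds
  filter_upwards [isOpen_upperHalfPlaneSet.mem_nhds hz] with w hw
  simp only [comp_apply]
  rw [← smul_ofComplex _ hw]
  exact weierstrassP_eichlerIntegral_gamma_smul f L hΛ γ (ofComplex w)

/-- `Γ₀(N)`-invariance of the order, for points of `ℍ`: the order of `w ↦ ℘_Λ(u(w))` at `γτ`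
equals its order at `τ`. [folklore] -/
theorem meromorphicOrderAt_weierstrassP_eichlerIntegral_smul (f : CuspForm (Gamma0 N) 2)
    (L : PeriodPair) (hΛ : ∀ x ∈ periodLattice f, x ∈ L.lattice) (γ : Gamma0 N) (τ : ℍ) :
    meromorphicOrderAt (fun w : ℂ ↦ ℘[L] (eichlerIntegral f (ofComplex w)))
        (((γ : SL(2, ℤ)) • τ : ℍ) : ℂ) =
      meromorphicOrderAt (fun w : ℂ ↦ ℘[L] (eichlerIntegral f (ofComplex w))) τ := by
  have h : (((γ : SL(2, ℤ)) • τ : ℍ) : ℂ) = moebius (γ : SL(2, ℤ)) τ := by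
    rw [← coe_smul_ofComplex _ τ.im_pos, ofComplex_apply]
  rw [h]
  exact meromorphicOrderAt_weierstrassP_eichlerIntegral_moebius f L hΛ γ τ.im_pos

/-! ### Removable singularities of `X·g` -/

/-- **Killing a pole.** If `X` is meromorphic of order `−n` at `z₀` and `g` is holomorphic at
`z₀` vanishing to order at least `n`, then `X·g` has non-negative order at `z₀`. [folklore] -/
theorem meromorphicOrderAt_mul_nonneg_of_natCast_le {X g : ℂ → ℂ} {z₀ : ℂ} {k : ℤ} {n : ℕ}
    (hX : MeromorphicAt X z₀) (hXo : meromorphicOrderAt X z₀ = (k : WithTop ℤ)) (hkn : -k ≤ n)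
    (hg : AnalyticAt ℂ g z₀) (hn : (n : ℕ∞) ≤ analyticOrderAt g z₀) :
    0 ≤ meromorphicOrderAt (X * g) z₀ := by
  rw [meromorphicOrderAt_mul hX hg.meromorphicAt, hXo, hg.meromorphicOrderAt_eq]
  cases h : analyticOrderAt g z₀ with
  | top => simp
  | coe j =>
    rw [h] at hn
    have hnj : n ≤ j := by exact_mod_cast hn
    rw [ENat.map_coe, ← WithTop.coe_add, WithTop.coe_nonneg]
    omega

/-- If `X` is holomorphic at `z₀` and `g` is holomorphic at `z₀`, then `X·g` has non-negative
order at `z₀`. [folklore] -/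
theorem meromorphicOrderAt_mul_nonneg_of_analyticAt {X g : ℂ → ℂ} {z₀ : ℂ}
    (hX : AnalyticAt ℂ X z₀) (hg : AnalyticAt ℂ g z₀) : 0 ≤ meromorphicOrderAt (X * g) z₀ :=
  (hX.mul hg).meromorphicOrderAt_nonneg

/-- **The normal form is holomorphic where the order is non-negative**: for `F` meromorphic on
`U` and `z ∈ U` with `ord_z F ≥ 0`, the normal form `toMeromorphicNFOn F U` is analytic at `z`
(Mathlib's meromorphic normal form; Riemann's removable singularity theorem). [folklore] -/
theorem analyticAt_toMeromorphicNFOn {F : ℂ → ℂ} {U : Set ℂ} (hF : MeromorphicOn F U) {z : ℂ}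
    (hz : z ∈ U) (h : 0 ≤ meromorphicOrderAt F z) : AnalyticAt ℂ (toMeromorphicNFOn F U) z := by
  rw [← (meromorphicNFOn_toMeromorphicNFOn F U hz).meromorphicOrderAt_nonneg_iff_analyticAt,
    meromorphicOrderAt_toMeromorphicNFOn hF hz]
  exact h

/-- The normal form agrees with `F` at every point of `U` where `F` is analytic. [folklore] -/
theorem toMeromorphicNFOn_apply_of_analyticAt {F : ℂ → ℂ} {U : Set ℂ} (hF : MeromorphicOn F U)
    {z : ℂ} (hz : z ∈ U) (h : AnalyticAt ℂ F z) : toMeromorphicNFOn F U z = F z := by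
  rw [toMeromorphicNFOn_eq_toMeromorphicNFAt hF hz, toMeromorphicNFAt_eq_self.2 h.meromorphicNFAt]

/-! ### Behaviour at a cusp -/

/-- A cuspidal `q`-series vanishing for `im τ` large vanishes identically (identity theorem on
the half-plane). [folklore] -/
theorem IsCuspFunction.eq_zero_of_eventually_eq_zero {h : ℝ} {φ : ℍ → ℂ} (hφ : IsCuspFunction h φ)
    (h0 : ∀ᶠ τ : ℍ in atImInfty, φ τ = 0) : φ = 0 := by
  obtain ⟨M, hM⟩ := (atImInfty_mem _).mp h0
  have han : AnalyticOnNhd ℂ (φ ∘ ofComplex) {z : ℂ | 0 < z.im} :=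
    (UpperHalfPlane.mdifferentiable_iff.mp hφ.mdifferentiable).analyticOnNhd isOpen_upperHalfPlaneSet
  set z₀ : ℂ := ((max M 1 + 1 : ℝ) : ℂ) * Complex.I with hz₀
  have hz₀im : z₀.im = max M 1 + 1 := by simp [hz₀]
  have hz₀U : z₀ ∈ {z : ℂ | 0 < z.im} := by
    simp only [mem_setOf_eq, hz₀im]; positivity
  have hev : (φ ∘ ofComplex) =ᶠ[𝓝 z₀] 0 := by
    have hO : IsOpen {z : ℂ | M < z.im} := isOpen_lt continuous_const Complex.continuous_im
    have hz₀O : z₀ ∈ {z : ℂ | M < z.im} := by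
      simp only [mem_setOf_eq, hz₀im]
      linarith [le_max_left M 1, le_max_right M 1]
    filter_upwards [hO.mem_nhds hz₀O, isOpen_upperHalfPlaneSet.mem_nhds hz₀U] with z (hz : M < z.im)
      (hz' : 0 < z.im)
    have := hM ⟨z, hz'⟩ (by simpa [UpperHalfPlane.im] using hz.le)
    simpa [comp_apply, ofComplex_apply_of_im_pos hz'] using this
  have heq := han.eqOn_zero_of_preconnected_of_eventuallyEq_zero
    convex_setOf_im_pos.isPreconnected hz₀U hev
  funext σ
  simpa [ofComplex_apply] using heq σ.im_pos

/-- The `q`-expansion `V̂` (`cuspFunction h V`) of a nonzero cuspidal `q`-series `V` is not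
identically zero near `q = 0`. [folklore] -/
theorem IsCuspFunction.not_eventually_cuspFunction_eq_zero {h : ℝ} {V : ℍ → ℂ}
    (hV : IsCuspFunction h V) (hV0 : V ≠ 0) : ¬ ∀ᶠ q in 𝓝 (0 : ℂ), cuspFunction h V q = 0 := by
  intro hz
  apply hV0
  have hh := hV.pos
  have hq : Tendsto (fun τ : ℍ ↦ Periodic.qParam h τ) atImInfty (𝓝 0) := qParam_tendsto_atImInfty hh
  apply hV.eq_zero_of_eventually_eq_zero
  filter_upwards [hq.eventually hz] with τ hτ
  rwa [eq_cuspFunction τ hh.ne' hV.periodic] at hτ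

/-- **Decay at a cusp.** Let `V ≢ 0` and `D` be cuspidal `q_h`-series, `C ∈ ℂ`, `Λ` a lattice.
Then for all `a ≥ 2m + 1`, `m = ord₀ V̂` the order of vanishing of the `q`-expansion of `V` at
`q = 0`, `℘_Λ(C + V(τ))·D(τ)^a → 0` as `im τ → ∞`: on the `q`-disc the function
`℘_Λ(C + V̂(q))·D̂(q)^a` is meromorphic at `0` of order `≥ −2m + a > 0` (`℘_Λ` has order `≥ −2`
everywhere, orders multiply under composition and add under products). This is the computation
of the order at a cusp of `x·G` for the meromorphic function `x = ℘_Λ(2πi∫f)` on `X₀(N)`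
(Diamond–Shurman §3.2). [folklore] -/
theorem IsCuspFunction.tendsto_weierstrassP_mul_pow_atImInfty {h : ℝ} {V D : ℍ → ℂ}
    (hV : IsCuspFunction h V) (hV0 : V ≠ 0) (hD : IsCuspFunction h D) (L : PeriodPair) (C : ℂ)
    {a : ℕ} (ha : 2 * analyticOrderNatAt (cuspFunction h V) 0 + 1 ≤ a) :
    Tendsto (fun τ : ℍ ↦ ℘[L] (C + V τ) * D τ ^ a) atImInfty (𝓝 0) := by
  have hh := hV.pos
  set Φ := cuspFunction h V with hΦ
  set Ψ := cuspFunction h D with hΨ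
  have hΦa : AnalyticAt ℂ Φ 0 :=
    analyticAt_cuspFunction_zero hh hV.periodic hV.mdifferentiable hV.isBoundedAtImInfty
  have hΨa : AnalyticAt ℂ Ψ 0 :=
    analyticAt_cuspFunction_zero hh hD.periodic hD.mdifferentiable hD.isBoundedAtImInfty
  have hΦ0 : Φ 0 = 0 := hV.isZeroAtImInfty.cuspFunction_apply_zero hh
  have hΨ0 : Ψ 0 = 0 := hD.isZeroAtImInfty.cuspFunction_apply_zero hh
  have hΦne := hV.not_eventually_cuspFunction_eq_zero hV0
  have hΦtop : analyticOrderAt Φ 0 ≠ ⊤ := by rwa [Ne, analyticOrderAt_eq_top]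
  set m := analyticOrderNatAt Φ 0 with hm
  -- the inner function `C + Φ`
  have hg : AnalyticAt ℂ (fun q ↦ C + Φ q) 0 := analyticAt_const.add hΦa
  have hnc : ¬ EventuallyConst (fun q ↦ C + Φ q) (𝓝 (0 : ℂ)) := by
    rw [eventuallyConst_iff_exists_eventuallyEq]
    rintro ⟨c, hc⟩
    apply hΦne
    have h0 : C + Φ 0 = c := hc.self_of_nhds
    filter_upwards [hc] with q hq
    have : Φ q = Φ 0 := by linear_combination hq - h0
    show Φ q = 0
    rw [this, hΦ0]
  have hsub : analyticOrderAt (fun q ↦ C + Φ q - (C + Φ 0)) 0 = m := by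
    have : (fun q ↦ C + Φ q - (C + Φ 0)) = Φ := by
      funext q; rw [hΦ0, add_zero, add_sub_cancel_left]
    rw [this, hm, Nat.cast_analyticOrderNatAt hΦtop]
  have hmer₁ : MeromorphicAt (℘[L] ∘ fun q ↦ C + Φ q) 0 :=
    (L.meromorphic_weierstrassP _).comp_analyticAt hg
  -- order of `℘ ∘ (C + Φ)` at `0` is at least `-2m`
  have hord₁ : ((-(2 * m : ℕ) : ℤ) : WithTop ℤ) ≤
      meromorphicOrderAt (℘[L] ∘ fun q ↦ C + Φ q) 0 := by
    by_cases hC : C ∈ L.lattice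
    · rw [(L.meromorphic_weierstrassP _).meromorphicOrderAt_comp hg hnc, hsub, ENat.map_coe,
        show C + Φ 0 = C by rw [hΦ0, add_zero], L.order_weierstrassP C hC,
        show (-2 : WithTop ℤ) = ((-2 : ℤ) : WithTop ℤ) by norm_num, ← WithTop.coe_mul,
        WithTop.coe_le_coe]
      push_cast
      omega
    · have han : AnalyticAt ℂ (℘[L] ∘ fun q ↦ C + Φ q) 0 := by
        refine AnalyticAt.comp (g := ℘[L]) ?_ hg
        rw [show C + Φ 0 = C by rw [hΦ0, add_zero]]
        exact L.analyticOnNhd_weierstrassP C hC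
      calc ((-(2 * m : ℕ) : ℤ) : WithTop ℤ) ≤ 0 := by
            exact_mod_cast (by omega : (-(2 * m : ℕ) : ℤ) ≤ 0)
        _ ≤ _ := han.meromorphicOrderAt_nonneg
  -- order of `Ψ ^ a` at `0` is at least `a`
  have hmer₂ : MeromorphicAt (Ψ ^ a) 0 := (hΨa.pow a).meromorphicAt
  have hord₂ : ((a : ℤ) : WithTop ℤ) ≤ meromorphicOrderAt (Ψ ^ a) 0 := by
    rw [(hΨa.pow a).meromorphicOrderAt_eq, analyticOrderAt_pow hΨa]
    have h1 : analyticOrderAt Ψ 0 ≠ 0 := hΨa.analyticOrderAt_ne_zero.mpr hΨ0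
    cases hΨo : analyticOrderAt Ψ 0 with
    | top =>
      have ha0 : a ≠ 0 := by omega
      simp [ha0]
    | coe k =>
      rw [hΨo] at h1
      have hk : 0 < k := Nat.pos_of_ne_zero (by exact_mod_cast h1)
      rw [nsmul_eq_mul, ← Nat.cast_mul, ENat.map_coe, WithTop.coe_le_coe]
      exact_mod_cast Nat.le_mul_of_pos_right a hk
  -- the product on the `q`-disc has positive order at `0`
  have hpos : 0 < meromorphicOrderAt ((℘[L] ∘ fun q ↦ C + Φ q) * Ψ ^ a) 0 := by
    rw [meromorphicOrderAt_mul hmer₁ hmer₂]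
    calc (0 : WithTop ℤ) < ((-(2 * m : ℕ) : ℤ) : WithTop ℤ) + ((a : ℤ) : WithTop ℤ) := by
          rw [← WithTop.coe_add, WithTop.coe_pos]
          omega
      _ ≤ _ := add_le_add hord₁ hord₂
  have hT := tendsto_zero_of_meromorphicOrderAt_pos hpos
  have hq : Tendsto (fun τ : ℍ ↦ Periodic.qParam h τ) atImInfty (𝓝[≠] 0) :=
    tendsto_nhdsWithin_iff.mpr ⟨qParam_tendsto_atImInfty hh,
      Eventually.of_forall fun τ ↦ by simp [Periodic.qParam, Complex.exp_ne_zero]⟩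
  refine (hT.comp hq).congr fun τ ↦ ?_
  simp only [comp_apply, Pi.mul_apply, Pi.pow_apply, hΦ, hΨ,
    eq_cuspFunction τ hh.ne' hV.periodic, eq_cuspFunction τ hh.ne' hD.periodic]

end Literature.NumberTheory.EllipticCurves.ModularForms

end
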